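import Summits.CriticalPhenomena.PercolationContinuityZ3.Theorems.Transplant.Slab111HubRoute1
import HarnessLib

/-!
# The HUB ROUTING of the `(111)`-films, IV: routing 2 and the swap pair (`hub_gml`)

builds on p205010 (kernel theorem, internal audit signed; external expert review pending) — NOT used in this file.  Lane `prim-bschramm`, seat
`prim-bschramm-p2` (gen 36; class C1b; memo `HOME/bschramm/P2-LATTICES.md` §130); helper file (`--supports stmt-CriticalPhenomena-4575 --as helper`).
From a `HubData` («Slab111HubData», «Slab111HubLegs») the SECOND routing of the swap pair: the rerouted path runs along the leg of `E₁`, the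
`F₁`-helix from `e₁` to `c`, the hub `H_A`, the `F₂`-helix to `e₂` and the leg of `E₂`; the attachment vertex is `c` with successor `H_A`; the branch
starts at `y`, runs along the `F₁`-helix to `d`, the hub `H_D`, the `F₃`-helix to `e₃`, the leg of `w'`.  With routing 1 («Slab111HubRoute1»:
successor `y`, branch head `H_A`) this is a SWAP PAIR: **`HubData.hub_gml`**, the hub routing lemma of the gen-36 design for
`HexShadow.ShapedLinkage 3 (Slab111.hexShadow k)`. [cite: DuminilCopinSidoraviciusTassion2016, §2.3 (proof of Fact 2: the three disjoint paths γ_u, γ_v, γ_w in B_R(z))]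
-/

noncomputable section

namespace Summit.CriticalPhenomena.PercolationContinuityZ3.Theorems.Transplant

open Literature.Probability.Percolation Literature.Probability.LatticeModels SimpleGraph
open scoped Classical

namespace Slab111

namespace HubData

variable {k : ℕ} {z : Site 2} {c0 : ℤ} {W PR : Set (slab111 k)} {E₁ E₂ w' : slab111 k} (D : HubData k z c0 W PR E₁ E₂ w')

/-- The rerouted path of routing 2. [folklore] -/
def SP2 : List (slab111 k) := (D.leg₁ ++ D.S1c.tail) ++ ((D.c :: D.HA :: D.S2 D.LA) ++ D.leg₂.tail).tail

/-- The branch of routing 2. [folklore] -/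
def Br2 : List (slab111 k) := D.Syd ++ (D.d :: D.HD :: (D.S3 D.LD ++ D.leg₃.tail)).tail

/-- `SP2` is a self-avoiding path `E₁ → E₂`. [folklore] -/
theorem gSP2 : GPath (film k) D.SP2 E₁ E₂ := by
  have gT : GPath (film k) ((D.c :: D.HA :: D.S2 D.LA) ++ D.leg₂.tail) D.c E₂ :=
    D.gT2.trans D.hl2 fun v hv2 hvT => by
      rcases List.mem_cons.1 hvT with h | h
      · exact absurd (h ▸ D.cdy_S1.1) (D.l2_S1 v hv2)
      rcases List.mem_cons.1 h with h | h
      · exact absurd h (D.l2_hub D.isHub_A v hv2)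
      · exact D.l2_S2 D.isHub_A v hv2 h
  have gH : GPath (film k) (D.leg₁ ++ D.S1c.tail) E₁ D.c := D.hl1.trans D.gS1c fun v hvS hv1 => D.l1_S1 v hv1 (D.S1c_sub v hvS)
  exact gH.trans gT fun v hvT hvH => by
    rcases List.mem_append.1 hvT with hvT | hvT
    · rcases List.mem_cons.1 hvT with h | h
      · exact h
      rcases List.mem_cons.1 h with h | h
      · rcases List.mem_append.1 hvH with h' | h'
        · exact absurd h (D.l1_hub D.isHub_A _ h')
        · exact absurd (D.S1c_sub _ (List.mem_of_mem_tail h')) (h ▸ D.hub_S1 D.isHub_A)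
      · rcases List.mem_append.1 hvH with h' | h'
        · exact absurd h (D.l1_S2 D.isHub_A v h')
        · exact absurd h (D.S1_S2 D.isHub_A v (D.S1c_sub _ (List.mem_of_mem_tail h')))
    · have hv2 : v ∈ D.leg₂ := List.mem_of_mem_tail hvT
      rcases List.mem_append.1 hvH with h' | h'
      · exact absurd hv2 (D.l12 v h')
      · exact absurd (D.S1c_sub _ (List.mem_of_mem_tail h')) (D.l2_S1 v hv2)

/-- `SP2` decomposed. [folklore] -/
theorem SP2_eq : D.SP2 = D.leg₁.dropLast ++ D.S1c ++ (D.HA :: D.S2 D.LA ++ D.leg₂.tail) := by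
  rw [SP2, D.hl1.eq_dropLast_concat]
  have hs : D.S1c = D.e₁ :: D.S1c.tail := D.gS1c.eq_cons
  conv_rhs => rw [hs]
  simp [HubData.e₁]

/-- Membership in `SP2`. [folklore] -/
theorem mem_SP2 {v : slab111 k} (hv : v ∈ D.SP2) : v ∈ D.leg₁ ∨ v ∈ D.S1c ∨ v = D.HA ∨ v ∈ D.S2 D.LA ∨ v ∈ D.leg₂ := by
  rw [SP2_eq] at hv
  rcases List.mem_append.1 hv with hv | hv
  · rcases List.mem_append.1 hv with h | h
    · exact Or.inl (List.mem_of_mem_dropLast h)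
    · exact Or.inr (Or.inl h)
  · rcases List.mem_cons.1 hv with h | h
    · exact Or.inr (Or.inr (Or.inl h))
    rcases List.mem_append.1 h with h | h
    · exact Or.inr (Or.inr (Or.inr (Or.inl h)))
    · exact Or.inr (Or.inr (Or.inr (Or.inr (List.mem_of_mem_tail h))))

/-- The interior of `SP2` lies in `PR`. [folklore] -/
theorem SP2_PR : ∀ x ∈ D.SP2.tail.dropLast, x ∈ PR := by
  intro x hx
  obtain ⟨hxm, hxE1, hxE2⟩ := D.gSP2.mem_interior hx
  rcases D.mem_SP2 hxm with h | h | h | h | h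
  · exact D.l1_PR x h hxE1
  · exact D.S1_PR x (D.S1c_sub x h)
  · exact h ▸ D.hHA
  · exact (D.S2_facts D.isHub_A).2.1 x h
  · exact D.l2_PR x h hxE2

/-- `c, H_A` are consecutive on `SP2`. [folklore] -/
theorem SP2_cHA : ∃ l₁ l₂ : List (slab111 k), D.SP2 = l₁ ++ D.c :: D.HA :: l₂ := by
  refine ⟨D.leg₁.dropLast ++ D.S1c.dropLast, D.S2 D.LA ++ D.leg₂.tail, ?_⟩
  rw [SP2_eq]
  conv_lhs => rw [D.gS1c.eq_dropLast_concat]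
  simp

/-- `Br2` is a self-avoiding path `y → w'`. [folklore] -/
theorem gBr2 : GPath (film k) D.Br2 D.y w' := by
  have gc : GPath (film k) (D.S3 D.LD ++ D.leg₃.tail) (rideV k z c0 D.F3 (D.LD + D.d₃)) w' :=
    (D.S3_facts D.isHub_D).1.trans D.hl3 fun v hv3 hvS => D.l3_S3 D.isHub_D v hv3 hvS
  have gb : GPath (film k) (D.HD :: (D.S3 D.LD ++ D.leg₃.tail)) D.HD w' := by
    refine gc.cons (D.adj_hub3 D.isHub_D) ?_
    intro h
    rcases List.mem_append.1 h with h | h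
    · exact (D.S3_facts D.isHub_D).2.2.2.1 D.isHub_D h
    · exact D.l3_hub D.isHub_D _ (List.mem_of_mem_tail h) rfl
  have ga : GPath (film k) (D.d :: D.HD :: (D.S3 D.LD ++ D.leg₃.tail)) D.d w' := by
    refine gb.cons D.adj_HD_d.symm ?_
    intro h
    rcases List.mem_cons.1 h with h | h
    · exact D.hub_S1 D.isHub_D (by change D.HD ∈ D.S1; rw [← h]; exact D.cdy_S1.2.1)
    rcases List.mem_append.1 h with h | h
    · exact D.S1_S3 D.isHub_D _ D.cdy_S1.2.1 h
    · exact D.l3_S1 _ (List.mem_of_mem_tail h) D.cdy_S1.2.1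
  exact D.gSyd.trans ga fun v hvB hvS => by
    rcases List.mem_cons.1 hvB with h | h
    · exact h
    rcases List.mem_cons.1 h with h | h
    · exact absurd (D.Syd_sub v hvS) (h ▸ D.hub_S1 D.isHub_D)
    rcases List.mem_append.1 h with h | h
    · exact absurd h (D.S1_S3 D.isHub_D v (D.Syd_sub v hvS))
    · exact absurd (D.Syd_sub v hvS) (D.l3_S1 v (List.mem_of_mem_tail h))

/-- Membership in `Br2`. [folklore] -/
theorem mem_Br2 {x : slab111 k} (hx : x ∈ D.Br2) : x ∈ D.Syd ∨ x = D.HD ∨ x ∈ D.S3 D.LD ∨ x ∈ D.leg₃ := by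
  rcases List.mem_append.1 hx with h | h
  · exact Or.inl h
  rcases List.mem_cons.1 h with h | h
  · exact Or.inr (Or.inl h)
  rcases List.mem_append.1 h with h | h
  · exact Or.inr (Or.inr (Or.inl h))
  · exact Or.inr (Or.inr (Or.inr (List.mem_of_mem_tail h)))

/-- `Br2 ⊆ W`. [folklore] -/
theorem Br2_W : ∀ x ∈ D.Br2, x ∈ W := by
  intro x hx
  rcases D.mem_Br2 hx with h | h | h | h
  · exact D.hPRW (D.S1_PR x (D.Syd_sub x h))
  · exact h ▸ D.hPRW D.hHD
  · exact (D.S3_facts D.isHub_D).2.1 x h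
  · exact D.l3_W x h

/-- `Br2` is off `SP2`. [folklore] -/
theorem Br2_off : ∀ x ∈ D.Br2, x ∉ D.SP2 := by
  intro x hx hxP
  have hx' := D.mem_Br2 hx
  rcases D.mem_SP2 hxP with hP | hP | hP | hP | hP
  · -- x ∈ leg₁
    rcases hx' with h | h | h | h
    · exact D.S1c_Syd _ ((D.l1_S1 x hP (D.Syd_sub x h)) ▸ D.e1_mem.2) h
    · exact D.l1_hub D.isHub_D x hP h
    · exact D.l1_S3 D.isHub_D x hP h
    · exact D.l13 x hP h
  · -- x ∈ S1c
    rcases hx' with h | h | h | h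
    · exact D.S1c_Syd x hP h
    · exact D.hub_S1 D.isHub_D (by change D.HD ∈ D.S1; rw [← h]; exact D.S1c_sub x hP)
    · exact D.S1_S3 D.isHub_D x (D.S1c_sub x hP) h
    · exact D.l3_S1 x h (D.S1c_sub x hP)
  · -- x = HA
    rcases hx' with h | h | h | h
    · exact D.hub_S1 D.isHub_A (by change D.HA ∈ D.S1; rw [← hP]; exact D.Syd_sub _ h)
    · exact D.HA_ne_HD (hP ▸ h)
    · exact (D.S3_facts D.isHub_D).2.2.2.1 D.isHub_A (by change D.HA ∈ D.S3 D.LD; rw [← hP]; exact h)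
    · exact D.l3_hub D.isHub_A x h hP
  · -- x ∈ S2 LA
    rcases hx' with h | h | h | h
    · exact D.S1_S2 D.isHub_A x (D.Syd_sub x h) hP
    · exact (D.S2_facts D.isHub_A).2.2.2.1 D.isHub_D (by change D.HD ∈ D.S2 D.LA; rw [← h]; exact hP)
    · exact D.S2_S3 D.isHub_A D.isHub_D x hP h
    · exact D.l3_S2 D.isHub_A x h hP
  · -- x ∈ leg₂
    rcases hx' with h | h | h | h
    · exact D.l2_S1 x hP (D.Syd_sub x h)
    · exact D.l2_hub D.isHub_D x hP h
    · exact D.l2_S3 D.isHub_D x hP h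
    · exact D.l23 x hP h

/-- **ROUTING 2** of the hub construction: attachment vertex `c`, successor `H_A`, branch head `y`.
[cite: DuminilCopinSidoraviciusTassion2016, §2.3 (proof of Fact 2: γ_u, γ_v, γ_w)] -/
def route₂ : VRouteData (film k) PR W E₁ E₂ w' :=
  VRouteData.ofPaths D.gSP2 D.hne D.SP2_PR D.SP2_cHA D.gBr2 D.Br2_W D.adj_c_y D.Br2_off

/-- The successor of routing 2 is `H_A`. [folklore] -/
@[simp] theorem route₂_y : D.route₂.y = D.HA := VRouteData.ofPaths_y _ _ _ _ _ _ _ _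

/-- The branch head of routing 2 is `y`. [folklore] -/
@[simp] theorem route₂_b : D.route₂.b = D.y := VRouteData.ofPaths_b _ _ _ _ _ _ _ _

/-- **THE HUB ROUTING LEMMA**: the data of a hub routing yield a SWAP PAIR of routings (`y₁ = b₂ = y`, `b₁ = y₂ = H_A`) — the form the node
«HexShadowVRouteData».`ShapedLinkage` asks for.  Uniform in all levels; no search.
[cite: DuminilCopinSidoraviciusTassion2016, §2.3 (proof of Fact 2: the three disjoint paths γ_u, γ_v, γ_w in B_R(z))] -/
theorem hub_gml (D : HubData k z c0 W PR E₁ E₂ w') : ∃ r₁ r₂ : VRouteData (film k) PR W E₁ E₂ w', r₁.y = r₂.b ∧ r₁.b = r₂.y :=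
  ⟨D.route₁, D.route₂, by rw [route₁_y, route₂_b], by rw [route₁_b, route₂_y]⟩

end HubData

end Slab111

end Summit.CriticalPhenomena.PercolationContinuityZ3.Theorems.Transplant

end
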